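import Summits.QuantumFields.BalabanUV.T4Continuum.Support.ShellMeasureWindowSection
import Mathlib.MeasureTheory.Function.Jacobian

/-!
# `T4Continuum.ShellMeasureLinearizedChart` — (LR)_j: THE CURVED FIBRE CHART FOR A LINEARIZABLE AVERAGE.
# A measurable `Φ`, injective and differentiable on a window `O`, pulls the block's Lebesgue law back with the
# Jacobian `|det Φ'|`; if `Φ` LINEARIZES the (nonlinear) average `Q` into the second coordinate of a linear
# splitting `Ψ : Kf × F ≃ E` (print's device «B′ = B − hD̃(B) linearizes Q̃(B′)»), then `x ↦ Φ (σ b + Ψ (x, 0))`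
# charts the fibre `{Q = b}` inside the window, and END-II (fibre form) applies in the coordinate `x : Kf`
# (cell `pub-balaban`, sub-cell `t4`, spine estimate NE7c (node U5b); NE7c ROUND-2 crew `t4-ne7c-formalise-*`, seat
# `b2b-balaban-t4-ne7c-formalise-leaf-09` (gen 7); an OFFERED file under the FC orbit («(LR)_j with print's fixed
# centre», leaf-10) addressing the typer's diagnostic T-NE7c-9 («linearity of the average = the declared MODEL; the
# curved fibre chart DISPLAYED»); journal `CLAIMS.log` l.11567; ADDITIVE — imports FC f4 `ShellMeasureWindowSection`
# (p212366) and Mathlib's change-of-variables file `MeasureTheory.Function.Jacobian` only, modifies nothing;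
# 0 `def`, 0 sorry, 0 cite)

HONEST FRAMING.  Finite four-torus programme, rung (B)+1 only — NOT infinite volume, NOT a mass gap, NOT the Clay
problem, NOT summit progress; (B), `BetaPertHyp`, (B^μ) are not consumed.  (M1) for Bałaban's inductively defined
effective measures is NOT PRINTED (GAPS G-ne7cp1-1), asserted by nobody, NOT moved here.  NE7c ⇐ the named binders
(trigger c3); NE7c NOT PRINTED, NOT proved; spine PROVED 0/9 before and after.  STRUCTURAL BOOKKEEPING — [folklore]
measure theory (Mathlib's change-of-variables theorem `lintegral_image_eq_lintegral_abs_det_fderiv_mul` and, through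
FC f4, uniqueness of Haar measure); no estimate, no `def` (c2), no citation.  HONEST DEPENDENCY (cell, verbatim):
continuum YM on T⁴ ⇐ BetaPertH ∧ nine spine estimates (0/9 proved); BetaPertH ⇐ (D1) ∧ (D4) ∧ CAP+tail; G-an2-4 gates
asym, D1 and NE2/3/4.

THE POINT.  FC f4 (`ShellMeasureWindowSection`, leaf-10 gen 3) charts the fibres of a LINEAR average `Q : E → F` of
the block variables by a linear splitting `Ψ : Kf × F ≃ E` and a section `σ` («centre at the section value of the
average, plus a fibre fluctuation»: `(x, b) ↦ σ b + Ψ (x, 0)`), and the typer recorded the linearity of the average as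
the declared MODEL of that END, «the curved fibre chart DISPLAYED» (DAG §4 T-NE7c-9; FC f6–f8 later weakened the
residual to translation-covariance in the last contour axis, and the locator G-ne7cL10g4-2 named the obstruction
elsewhere).  Print does not keep the average linear: it LINEARIZES it.  [Balaban1987RG1] p. 267: «We are looking for
an analytic, 𝐠-valued function D̃(B′) … such that the transformation B′ = B − hD̃(B) linearizes the function Q̃(B′) …
The above change of variables yields the integral with the δ-function δ(Q̃B)» (the same device in [15] Sect. C and
[14] Sect. E; typed in the tree as `B12Lineariz267` / `B12LinearizAnalytic267` / `B12JacobianTrLog268` /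
`B12JacobianReal267` over complexified configuration spaces — NOT imported here).  This file supplies the abstract
measure theory of that device for the realized-(M1) ENDs:
* §1 `map_withDensity_jacobian` — for a measurable `Φ : E → E`, injective on a measurable `O` with derivative `Φ'`
  within `O`, and a density `G`: `((μE⌞O).withDensity (|det Φ'|·G∘Φ)).map Φ = (μE⌞Φ(O)).withDensity G`;
  `slotAC_of_curvedChart` — (M1) for the block law `(μE⌞Φ(O)).withDensity G` with tested variable `u` FOLLOWS from
  (M1) for the pulled-back law with `u ∘ Φ`, same `θ, ρ, D`.
* §2 `slotAC_of_linearizedChart` — §1 ∘ FC f4 `slotAC_of_sectionChart`: (M1) for the block law ⇐ (M1) for the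
  PRODUCT law (fibre model ⊗ average space) tilted by the pulled-back density at the charted point
  `σ b + Ψ (x, 0)`, tested variable `u (Φ (σ b + Ψ (x, 0)))`.
* §3 THE CURVED FIBRE CHART — under the linearization hypothesis `hlin : ∀ y ∈ O, Q (Φ y) = (Ψ.symm y).2` the
  charted point `Φ (σ b + Ψ (x, 0))` HAS AVERAGE `b` (`average_linearizedChart`), every point of the fibre
  `{Q = b}` inside the window `Φ(O)` is such a charted point (`exists_fibreCoord`), for exactly one `x`
  (`fibreCoord_unique`); print's window about the centre `σ b` is a FIXED ball in `x` (FC f4 `window_sectionChart`).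
* §4 THE END `slotAC_linearizedWindow_of_levelData` — FC f4's `slotAC_sectionWindow_of_levelData` WORD FOR WORD
  except: per exterior point `z` a chart `(O z, Φ z, Φ' z)` as in §1; the slot density `G` supported in the chart
  images (print's small-field characteristic function); the pulled-back density `Gt z = 1_{O z}·|det Φ' z|·G(Φ z ·, z)`
  carries `hfin`, the dictionary and E2′'s SM-L1…L6 binders at the charted point, the tested variable being read at
  `Φ z (σ z b + Ψ (x, 0))`.  CONCLUSION LITERALLY `SlotAntiConcentration ((μE.prod ζ).withDensity G) u θ ρ
  (2(finrank ℝ Kf + β Σ_p L̄_p(d̄_p + 4s̄_p) + B_𝓔)/(1−δ))` — f4's, consumed unchanged by END-I's seam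
  `ShellMeasureRootCompositionSeam.hac_of_slotConst`.  SANITY `example`: the identity chart (`Φ z = id`, `O z = univ`)
  recovers f4's END, statement copied.
CONSEQUENCE FOR THE LEDGER (c3-honest).  T-NE7c-9's declared MODEL «the average is linear» is REPLACED by the
displayed-TYPE hypothesis «the average is LINEARIZABLE about the step's background on the window» — the property
print asserts (B12 p. 267) and the tree types (`B12Lineariz267.linearizes`, injectivity on the ball, the strict
derivative `DΦ = I − h∘DD̃`, `det DΦ > 0` on the real ball).  The Jacobian `|det Φ'|` rides INSIDE the density — it is
print's (2.12) term «Tr log(I − h(δ/δB)D̃)»; its share of SM-L4's ray bound is NOT claimed here.  The REAL-FORM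
junction to the B12 leaves (typed over complexified spaces with conjugations) is NOT in this file.
WHAT THIS DOES NOT DO.  No instance of SM-L1/L3/L4/L6 at any `j ≥ 1`; Bałaban's block average is not shown
linearizable here (that is print's statement, typed elsewhere); (M1) per slot stays THE wall; NE7c NOT proved; 0/9.
-/

noncomputable section

open Set Function MeasureTheory MeasureTheory.Measure Metric

namespace Summit.QuantumFields.BalabanUV.T4Continuum.ShellMeasureLinearizedChart

open scoped ENNReal NNReal
open Literature.MathematicalPhysics.QuantumFieldTheory.Balaban1983to89
open T4ShellMeasure (SlotAntiConcentration)
open T4ShellMeasureLocal (slotAntiConcentration_of_sections)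
open T4ShellMeasureDet (slotAntiConcentration_map withDensity_map_eq_map_withDensity_comp)
open ShellMeasureWilsonTrace (TraceData)
open ShellMeasureWilsonMoving (MLetter mwordEval mdFro sSum lSum)
open ShellMeasureLevelAssembly (classifier weight)
open ShellMeasureRootCompositionFibre (slotAC_fibre_of_levelData)
open ShellMeasureWindowSection (slotAC_of_sectionChart average_sectionChart measurePreserving_sectionChart)

variable {E F : Type*} [NormedAddCommGroup E] [NormedSpace ℝ E] [MeasurableSpace E] [BorelSpace E]
  [FiniteDimensional ℝ E] (μE : Measure E) [μE.IsAddHaarMeasure]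

/-! ## §1 Change of variables under a curved chart; (M1) pulls back -/

section Curved

/-- **CHANGE OF VARIABLES UNDER A CURVED CHART, WITH A DENSITY.**  For a measurable `Φ : E → E`, injective on a
measurable `O` with derivative `Φ' y` within `O` at every `y ∈ O`, and any density `G`: the image under `Φ` of the
block's Lebesgue law on `O` tilted by `|det Φ' y| · G (Φ y)` IS the Lebesgue law on `Φ(O)` tilted by `G` — Mathlib's
`lintegral_image_eq_lintegral_abs_det_fderiv_mul`, set by set. [folklore] -/
theorem map_withDensity_jacobian {O : Set E} (hO : MeasurableSet O) {Φ : E → E} (hΦm : Measurable Φ)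
    (hinj : InjOn Φ O) {Φ' : E → E →L[ℝ] E} (hΦ' : ∀ y ∈ O, HasFDerivWithinAt Φ (Φ' y) O y)
    (G : E → ℝ≥0∞) :
    ((μE.restrict O).withDensity fun y => ENNReal.ofReal |(Φ' y).det| * G (Φ y)).map Φ =
      (μE.restrict (Φ '' O)).withDensity G := by
  ext A hA
  rw [Measure.map_apply hΦm hA, withDensity_apply _ (hΦm hA), withDensity_apply _ hA,
    Measure.restrict_restrict (hΦm hA), Measure.restrict_restrict hA, ← image_preimage_inter]
  exact (lintegral_image_eq_lintegral_abs_det_fderiv_mul μE ((hΦm hA).inter hO)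
    (fun y hy => (hΦ' y hy.2).mono inter_subset_right) (hinj.mono inter_subset_right) G).symm

/-- **(M1) PULLS BACK THROUGH A CURVED CHART.**  (M1) for the block law `(μE⌞Φ(O)).withDensity G` with a measurable
tested variable `u` FOLLOWS from (M1) for the pulled-back law `(μE⌞O).withDensity (|det Φ'|·G∘Φ)` with the variable
`u ∘ Φ`, SAME `θ, ρ, D` (`T4ShellMeasureDet.slotAntiConcentration_map` on §1's identity). [folklore] -/
theorem slotAC_of_curvedChart {O : Set E} (hO : MeasurableSet O) {Φ : E → E} (hΦm : Measurable Φ)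
    (hinj : InjOn Φ O) {Φ' : E → E →L[ℝ] E} (hΦ' : ∀ y ∈ O, HasFDerivWithinAt Φ (Φ' y) O y)
    (G : E → ℝ≥0∞) {u : E → ℝ} (hu : Measurable u) {θ ρ D : ℝ}
    (h : SlotAntiConcentration ((μE.restrict O).withDensity fun y => ENNReal.ofReal |(Φ' y).det| * G (Φ y))
      (u ∘ Φ) θ ρ D) :
    SlotAntiConcentration ((μE.restrict (Φ '' O)).withDensity G) u θ ρ D := by
  rw [← map_withDensity_jacobian μE hO hΦm hinj hΦ' G]
  exact slotAntiConcentration_map hΦm hu h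

omit [μE.IsAddHaarMeasure] in
/-- **A DENSITY SUPPORTED IN THE WINDOW.**  If `G` vanishes off `Φ(O)` (print's small-field characteristic function
sits inside the integrand) the block law `μE.withDensity G` IS the law on the chart image: no restriction is lost.
[folklore] -/
theorem withDensity_eq_restrict_image {O : Set E} (hO : MeasurableSet O) {Φ : E → E} (hinj : InjOn Φ O)
    {Φ' : E → E →L[ℝ] E} (hΦ' : ∀ y ∈ O, HasFDerivWithinAt Φ (Φ' y) O y) {G : E → ℝ≥0∞}
    (hGsupp : ∀ y, G y ≠ 0 → y ∈ Φ '' O) :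
    μE.withDensity G = (μE.restrict (Φ '' O)).withDensity G := by
  rw [← withDensity_indicator (measurable_image_of_fderivWithin hO hΦ' hinj), indicator_eq_self.2 hGsupp]

end Curved

/-! ## §2 The curved chart composed with the linear section chart of FC f4 -/

section Linearized

variable {Kf : Type*} [NormedAddCommGroup F] [NormedSpace ℝ F] [MeasurableSpace F] [BorelSpace F]
  [FiniteDimensional ℝ F] [NormedAddCommGroup Kf] [NormedSpace ℝ Kf] [MeasurableSpace Kf] [BorelSpace Kf]
  [FiniteDimensional ℝ Kf] (μK : Measure Kf) [μK.IsAddHaarMeasure] (μF : Measure F) [μF.IsAddHaarMeasure]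

/-- **(M1) THROUGH THE LINEARIZED CHART.**  Data: a linear splitting `Ψ : Kf × F ≃ E` with a measurable section `σ`
(`(Ψ.symm (σ b)).2 = b`), a curved chart `(O, Φ, Φ')` as in §1, a measurable density `G` and tested variable `u` on
the block, and the PULLED-BACK DENSITY `Gt = 1_O · |det Φ'| · G ∘ Φ` (measurable).  Then (M1) for the block law
`(μE⌞Φ(O)).withDensity G` with `u` FOLLOWS from (M1) for the PRODUCT law `μK ⊗ μF` tilted by `Gt` at the charted point
`σ b + Ψ (x, 0)` with the variable `u (Φ (σ b + Ψ (x, 0)))`, SAME `θ, ρ, D` — §1 ∘ FC f4 `slotAC_of_sectionChart`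
(both constants cancel in (M1)). [folklore] -/
theorem slotAC_of_linearizedChart (Ψ : (Kf × F) ≃L[ℝ] E) {σ : F → E} (hσm : Measurable σ)
    (hσ : ∀ b, (Ψ.symm (σ b)).2 = b) {O : Set E} (hO : MeasurableSet O) {Φ : E → E} (hΦm : Measurable Φ)
    (hinj : InjOn Φ O) {Φ' : E → E →L[ℝ] E} (hΦ' : ∀ y ∈ O, HasFDerivWithinAt Φ (Φ' y) O y)
    (G : E → ℝ≥0∞) {Gt : E → ℝ≥0∞} (hGtm : Measurable Gt)
    (hGt : ∀ y, Gt y = O.indicator (fun y => ENNReal.ofReal |(Φ' y).det| * G (Φ y)) y)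
    {u : E → ℝ} (hu : Measurable u) {θ ρ D : ℝ}
    (h : SlotAntiConcentration ((μK.prod μF).withDensity fun p => Gt (σ p.2 + Ψ (p.1, 0)))
      (fun p => u (Φ (σ p.2 + Ψ (p.1, 0)))) θ ρ D) :
    SlotAntiConcentration ((μE.restrict (Φ '' O)).withDensity G) u θ ρ D := by
  refine slotAC_of_curvedChart μE hO hΦm hinj hΦ' G hu ?_
  have hGt' : Gt = O.indicator fun y => ENNReal.ofReal |(Φ' y).det| * G (Φ y) := funext hGt
  rw [← withDensity_indicator hO, ← hGt']
  exact slotAC_of_sectionChart μK μF μE Ψ hσm hσ hGtm (hu.comp hΦm) h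

/-- **THE BLOCK LAW DISINTEGRATES ALONG THE LINEARIZED AVERAGE INTO THE CURVED-CHART FIBRE LAWS.**  With the data
of `slotAC_of_linearizedChart`: the image of the PRODUCT law `μK ⊗ μF` tilted by the pulled-back density `Gt` at the
charted point, under the full chart `(x, b) ↦ Φ (σ b + Ψ (x, 0))`, is `c • (μE⌞Φ(O)).withDensity G` for a constant
`0 < c < ∞` (the Lebesgue normalisation of the splitting, FC f4 `measurePreserving_sectionChart`) — i.e. integrating
the fibre laws «`x ↦ Φ (σ b + Ψ (x, 0))` pushes `Gt (σ b + Ψ (x, 0)) dμK(x)`» against Lebesgue `db` on the average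
space returns the block law: the measure-theoretic content of print's «the above change of variables yields the
integral with the δ-function δ(Q̃B)».  This is what makes the CONSTRAINED reading's fibre law (the `b`-slice of this
product form) a definition-independent object. [folklore] -/
theorem map_linearizedChart_eq_smul (Ψ : (Kf × F) ≃L[ℝ] E) {σ : F → E} (hσm : Measurable σ)
    (hσ : ∀ b, (Ψ.symm (σ b)).2 = b) {O : Set E} (hO : MeasurableSet O) {Φ : E → E} (hΦm : Measurable Φ)
    (hinj : InjOn Φ O) {Φ' : E → E →L[ℝ] E} (hΦ' : ∀ y ∈ O, HasFDerivWithinAt Φ (Φ' y) O y)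
    (G : E → ℝ≥0∞) {Gt : E → ℝ≥0∞} (hGtm : Measurable Gt)
    (hGt : ∀ y, Gt y = O.indicator (fun y => ENNReal.ofReal |(Φ' y).det| * G (Φ y)) y) :
    ∃ c : ℝ≥0∞, c ≠ 0 ∧ c ≠ ∞ ∧
      ((μK.prod μF).withDensity fun p => Gt (σ p.2 + Ψ (p.1, 0))).map (fun p => Φ (σ p.2 + Ψ (p.1, 0))) =
        c • (μE.restrict (Φ '' O)).withDensity G := by
  obtain ⟨c, hc0, hc1, he⟩ := measurePreserving_sectionChart μK μF μE Ψ hσm hσ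
  refine ⟨c, hc0, hc1, ?_⟩
  have hch : Measurable fun p : Kf × F => σ p.2 + Ψ (p.1, 0) := he.measurable
  have hGt' : Gt = O.indicator fun y => ENNReal.ofReal |(Φ' y).det| * G (Φ y) := funext hGt
  have h1 : ((μK.prod μF).withDensity fun p => Gt (σ p.2 + Ψ (p.1, 0))).map
      (fun p : Kf × F => σ p.2 + Ψ (p.1, 0)) = c • μE.withDensity Gt := by
    rw [← withDensity_smul_measure, ← he.map_eq]
    exact (withDensity_map_eq_map_withDensity_comp hch hGtm).symm
  have hcomp : (fun p : Kf × F => Φ (σ p.2 + Ψ (p.1, 0))) = Φ ∘ fun p => σ p.2 + Ψ (p.1, 0) := rfl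
  rw [hcomp, ← Measure.map_map hΦm hch, h1, Measure.map_smul, hGt', withDensity_indicator hO,
    map_withDensity_jacobian μE hO hΦm hinj hΦ' G]

end Linearized

/-! ## §3 The curved fibre chart: average, coverage, uniqueness -/

section FibreChart

variable {Kf : Type*} [NormedAddCommGroup F] [NormedSpace ℝ F] [NormedAddCommGroup Kf] [NormedSpace ℝ Kf]

omit [MeasurableSpace E] [BorelSpace E] [FiniteDimensional ℝ E] in
/-- **THE CHARTED POINT HAS AVERAGE `b`.**  If `Φ` LINEARIZES the average `Q` on the window `O` into the splitting's
second coordinate (`Q (Φ y) = (Ψ.symm y).2` for `y ∈ O` — print's «B′ = B − hD̃(B) linearizes Q̃(B′)»), then for a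
section `σ` and any fibre coordinate `x` with `σ b + Ψ (x, 0) ∈ O`: `Q (Φ (σ b + Ψ (x, 0))) = b`. [folklore] -/
theorem average_linearizedChart (Ψ : (Kf × F) ≃L[ℝ] E) {σ : F → E} (hσ : ∀ b, (Ψ.symm (σ b)).2 = b)
    {O : Set E} {Φ : E → E} {Q : E → F} (hlin : ∀ y ∈ O, Q (Φ y) = (Ψ.symm y).2) (x : Kf) (b : F)
    (hx : σ b + Ψ (x, 0) ∈ O) : Q (Φ (σ b + Ψ (x, 0))) = b := by
  rw [hlin _ hx, average_sectionChart Ψ hσ]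

omit [MeasurableSpace E] [BorelSpace E] [FiniteDimensional ℝ E] in
/-- **THE CHART COVERS THE FIBRE INSIDE THE WINDOW.**  Under the linearization hypothesis, every point `y` of the
window image `Φ(O)` with average `Q y = b` is a charted point `Φ (σ b + Ψ (x, 0))` with `σ b + Ψ (x, 0) ∈ O` — the
fibre coordinate is `x = (Ψ.symm w).1 − (Ψ.symm (σ b)).1` for the pre-image `w ∈ O` of `y`. [folklore] -/
theorem exists_fibreCoord (Ψ : (Kf × F) ≃L[ℝ] E) {σ : F → E} (hσ : ∀ b, (Ψ.symm (σ b)).2 = b)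
    {O : Set E} {Φ : E → E} {Q : E → F} (hlin : ∀ y ∈ O, Q (Φ y) = (Ψ.symm y).2) {y : E} (hy : y ∈ Φ '' O)
    {b : F} (hb : Q y = b) : ∃ x : Kf, σ b + Ψ (x, 0) ∈ O ∧ Φ (σ b + Ψ (x, 0)) = y := by
  obtain ⟨w, hw, rfl⟩ := hy
  refine ⟨(Ψ.symm w).1 - (Ψ.symm (σ b)).1, ?_⟩
  have hw2 : (Ψ.symm w).2 = b := by rw [← hlin w hw, hb]
  have hdec : σ b + Ψ ((Ψ.symm w).1 - (Ψ.symm (σ b)).1, 0) = w := by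
    have h1 : Ψ ((Ψ.symm w).1 - (Ψ.symm (σ b)).1, 0) = Ψ (Ψ.symm w) - Ψ (Ψ.symm (σ b)) := by
      rw [← map_sub]
      congr 1
      ext <;> simp [hw2, hσ b]
    rw [h1, ContinuousLinearEquiv.apply_symm_apply, ContinuousLinearEquiv.apply_symm_apply]
    abel
  exact ⟨by rw [hdec]; exact hw, by rw [hdec]⟩

omit [MeasurableSpace E] [BorelSpace E] [FiniteDimensional ℝ E] in
/-- **… FOR EXACTLY ONE FIBRE COORDINATE.**  `x ↦ Φ (σ b + Ψ (x, 0))` is injective on `{x | σ b + Ψ (x, 0) ∈ O}`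
(`Φ` injective on `O`, `Ψ` injective). [folklore] -/
theorem fibreCoord_unique (Ψ : (Kf × F) ≃L[ℝ] E) (σ : F → E) {O : Set E} {Φ : E → E} (hinj : InjOn Φ O)
    (b : F) : InjOn (fun x : Kf => Φ (σ b + Ψ (x, 0))) {x | σ b + Ψ (x, 0) ∈ O} := by
  intro x hx x' hx' h
  have h1 : σ b + Ψ (x, 0) = σ b + Ψ (x', 0) := hinj hx hx' h
  have h2 : (x, (0 : F)) = (x', 0) := Ψ.injective (add_left_cancel h1)
  exact (Prod.ext_iff.1 h2).1

end FibreChart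

/-! ## §4 END-II, marginal reading, LINEARIZABLE average -/

section End

variable {Kf : Type*} [NormedAddCommGroup F] [NormedSpace ℝ F] [MeasurableSpace F] [BorelSpace F]
  [FiniteDimensional ℝ F] [NormedAddCommGroup Kf] [NormedSpace ℝ Kf] [MeasurableSpace Kf] [BorelSpace Kf]
  [FiniteDimensional ℝ Kf] (μK : Measure Kf) [μK.IsAddHaarMeasure]
variable {A : Type*} [NormedRing A] [NormedAlgebra ℂ A] [CompleteSpace A] [NormOneClass A]

/-- **END-II, MARGINAL READING, LINEARIZABLE AVERAGE — REALIZED (M1) ⇐ SM-L1…L6 + DICTIONARY IN THE CURVED FIBRE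
COORDINATE, PER SLOT, ANY LEVEL.**  Data: the block space `E` with additive Haar (Lebesgue) measure `μE`; the average
space `F` and a fibre model `Kf` (`μK`); ANY
exterior space `Z` with an s-finite law `ζ`; the realized slot law `((μE.prod ζ).withDensity G)` — PRODUCT LEBESGUE ON
THE BLOCK VARIABLES with a measurable density `G` — and a measurable tested variable `u`; for every exterior point `z`:
a linear splitting `Ψ z : Kf × F ≃ E` (of the LINEARIZED average, which may depend on the background), a
measurable window `O z`, a measurable chart `Φ z` injective on `O z` with derivative `Φ' z` within `O z` (print's
linearizing substitution about the step's background), the density `G (·, z)` SUPPORTED in `Φ z '' O z` (`hGsupp` —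
print's small-field characteristic function inside the integrand), a measurable SECTION `σ z` of the linearized
average (`((Ψ z).symm (σ z b)).2 = b`), and the measurable PULLED-BACK DENSITY `Gt z = 1_{O z} · |det Φ' z| · G (Φ z ·, z)`
(`hGt`); finiteness of the tilted FIBRE laws `hfin`.  LEVEL DATA per `(z, b)` IN THE FIBRE COORDINATE `x : Kf` (E2′'s):
`hol`, `Gw`, `𝓔`, `W`, `Jco`, sizes, numbers; DICTIONARY `hFdict` (`Gt z` at the charted point `σ z b + Ψ z (x, 0)` IS
`Jco · weight` — the Jacobian rides inside `Jco`/`weight` as the supplier decides), `hudict` (`u` at the IMAGE point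
`Φ z (σ z b + Ψ z (x, 0))` IS the classifier, on the support); BINDERS `hJW`/`hJ` (SM-L5/L6), `hAN` (SM-L1), `hGW`
(SM-L3), `hE` (SM-L4), `hSM` (SM-L2) — token-identical with FC f4's.  CONCLUSION: `SlotAntiConcentration
((μE.prod ζ).withDensity G) u θ ρ (2(finrank ℝ Kf + β Σ_p L̄_p(d̄_p + 4s̄_p) + B_𝓔)/(1−δ))` — f4's LITERALLY (f4 = the
case `Φ z = id`, `O z = univ`, `Ψ z = Ψ`).  Proof:
sections over `z` ∘ §1 (support, curved chart) ∘ FC f4 `slotAC_of_sectionChart` ∘ FC f3 `slotAC_fibre_of_levelData`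
with exterior := the average value `b`.  CONDITIONAL on every binder; the LINEARIZABILITY of the average on the window
is the displayed-TYPE hypothesis (print's, B12 p. 267); nothing PRINTED is asserted. [folklore] -/
theorem slotAC_linearizedWindow_of_levelData {Z : Type*} [MeasurableSpace Z] (Ψ : Z → (Kf × F) ≃L[ℝ] E)
    (ζ : Measure Z) [SFinite ζ] {G : E × Z → ℝ≥0∞} (hG : Measurable G) {u : E × Z → ℝ} (hu : Measurable u)
    -- the curved chart per exterior point (print's linearizing substitution on the window)
    {O : Z → Set E} (hO : ∀ z, MeasurableSet (O z)) {Φ : Z → E → E} (hΦm : ∀ z, Measurable (Φ z))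
    (hinj : ∀ z, InjOn (Φ z) (O z)) {Φ' : Z → E → E →L[ℝ] E}
    (hΦ' : ∀ z, ∀ y ∈ O z, HasFDerivWithinAt (Φ z) (Φ' z y) (O z) y)
    (hGsupp : ∀ z y, G (y, z) ≠ 0 → y ∈ Φ z '' O z)
    {σ : Z → F → E} (hσm : ∀ z, Measurable (σ z)) (hσ : ∀ z b, ((Ψ z).symm (σ z b)).2 = b)
    -- the pulled-back density (Jacobian × density ∘ chart, on the window)
    {Gt : Z → E → ℝ≥0∞} (hGtm : ∀ z, Measurable (Gt z))
    (hGt : ∀ z y, Gt z y = (O z).indicator (fun y => ENNReal.ofReal |(Φ' z y).det| * G (Φ z y, z)) y)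
    (hfin : ∀ z b, (μK.withDensity fun x => Gt z (σ z b + Ψ z (x, 0))) univ ≠ ∞)
    -- level data per exterior point AND average value, in the fibre coordinate
    (Ttr : TraceData A) (hN : 0 < Ttr.N) {ι κ : Type*} {Pu : Finset ι} (hPu : Pu.Nonempty)
    (hol : Z → F → ι → Kf → A) (hcont : ∀ z b, ∀ p ∈ Pu, Continuous (hol z b p))
    (Pw : Finset κ) (Gw : Z → F → κ → Kf → A) (𝓔 : Z → F → Kf → ℝ) (W : Z → F → Set Kf)
    (Jco : Z → F → Kf → ℝ≥0∞) {θ δ ρ β Rad H B𝓔 : ℝ} {sw lw dw : κ → ℝ}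
    -- DICTIONARY at the charted point
    (hFdict : ∀ z b x, Gt z (σ z b + Ψ z (x, 0)) = Jco z b x * weight Ttr β Pw (Gw z b) (𝓔 z b) x)
    (hudict : ∀ z b x, Gt z (σ z b + Ψ z (x, 0)) ≠ 0 →
      u (Φ z (σ z b + Ψ z (x, 0)), z) = classifier hPu (hol z b) x)
    -- SM-L5/L6: kept co-tests supported in the window, centre-monotone
    (hJW : ∀ z b x, Jco z b x ≠ 0 → x ∈ W z b)
    (hJ : ∀ z b x, ∀ a : ℝ, 0 ≤ a → Jco z b x ≤ Jco z b (Real.exp (-a) • x))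
    -- SM-L1 (AN-bound)
    (hRad : 1 < Rad)
    (hAN : ∀ z b, ∀ x ∈ W z b, ∀ p ∈ Pu, ∃ f : ℂ → A, DifferentiableOn ℂ f (ball 0 Rad) ∧
      (∀ w ∈ ball (0 : ℂ) Rad, ‖f w‖ ≤ H) ∧ f 0 = 0 ∧
      ∀ c' : ℝ, 0 ≤ c' → c' ≤ 1 → f (c' : ℂ) = hol z b p (c' • x) - 1)
    -- SM-L3 graded sectioned words
    (hGW : ∀ z b, ∀ x ∈ W z b, ∀ p ∈ Pw, ∃ gw : List (MLetter A × ℝ × ℝ), (∀ y ∈ gw, y.1.Good Ttr.τ y.2.1 y.2.2) ∧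
      sSum gw ≤ sw p ∧ lSum gw ≤ lw p ∧ mdFro (gw.map Prod.fst) ≤ dw p ∧
      ∀ c' : ℝ, 0 ≤ c' → c' ≤ 1 → mwordEval c' (gw.map Prod.fst) = Gw z b p (c' • x))
    (hsw1 : ∀ p ∈ Pw, sw p ≤ 1) (hsw0 : ∀ p ∈ Pw, 0 ≤ sw p) (hlw0 : ∀ p ∈ Pw, 0 ≤ lw p)
    (hdw0 : ∀ p ∈ Pw, 0 ≤ dw p)
    -- SM-L4 non-Wilson ray bound
    (hE : ∀ z b, ∀ x ∈ W z b, ∀ c' : ℝ, 1 / 2 ≤ c' → c' ≤ 1 → 𝓔 z b (c' • x) ≤ 𝓔 z b x + (1 - c') * B𝓔)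
    (hB𝓔 : 0 ≤ B𝓔)
    -- numbers + SM-L2 (SM)
    (hθ : 0 < θ) (hδ0 : 0 ≤ δ) (hδ1 : δ < 1) (hρ0 : 0 ≤ ρ) (hρ : ρ ≤ (1 - δ) / 2) (hβ : 0 ≤ β)
    (hSM : 36 * H * 1 ^ 2 / (Rad - 1) ^ 2 ≤ δ * θ) :
    SlotAntiConcentration ((μE.prod ζ).withDensity G) u θ ρ
      (2 * ((Module.finrank ℝ Kf : ℝ) + (β * ∑ p ∈ Pw, lw p * (dw p + 4 * sw p) + B𝓔)) / (1 - δ)) := by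
  refine slotAntiConcentration_of_sections μE ζ hG hu fun z => ?_
  have hGz : Measurable fun y : E => G (y, z) := hG.comp measurable_prodMk_right
  have huz : Measurable fun y : E => u (y, z) := hu.comp measurable_prodMk_right
  -- the density is supported in the chart image: the block law IS the law on `Φ z '' O z`
  rw [withDensity_eq_restrict_image μE (hO z) (hinj z) (hΦ' z) (G := fun y => G (y, z)) (hGsupp z)]
  -- pull back through the curved chart, then through FC f4's section chart
  refine slotAC_of_linearizedChart μE μK (addHaar : Measure F) (Ψ z) (hσm z) (hσ z) (hO z) (hΦm z) (hinj z)
    (hΦ' z) (fun y => G (y, z)) (hGtm z) (hGt z) huz ?_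
  -- (M1) for the product law tilted by `Gt z ∘ chart`: FC f3's fibre END with exterior := the average value
  have hch : Measurable fun p : Kf × F => σ z p.2 + Ψ z (p.1, 0) :=
    ((hσm z).comp measurable_snd).add
      ((Ψ z).continuous.measurable.comp (measurable_fst.prodMk measurable_const))
  exact slotAC_fibre_of_levelData μK (addHaar : Measure F) (F := fun p : Kf × F => Gt z (σ z p.2 + Ψ z (p.1, 0)))
    ((hGtm z).comp hch) (hfin z) (u := fun p : Kf × F => u (Φ z (σ z p.2 + Ψ z (p.1, 0)), z))
    (huz.comp ((hΦm z).comp hch)) Ttr hN hPu (hol z) (hcont z) Pw (Gw z) (𝓔 z) (W z) (Jco z) (hFdict z)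
    (hudict z) (hJW z) (hJ z) hRad (hAN z) (hGW z) hsw1 hsw0 hlw0 hdw0 (hE z) hB𝓔 hθ hδ0 hδ1 hρ0 hρ hβ hSM

/-- **SANITY: THE IDENTITY CHART RECOVERS FC f4.**  With `O z = univ`, `Φ z = id`, `Φ' z y = id` (`|det| = 1`) and one
splitting `Ψ`, the pulled-back density is `G (·, z)` itself and `slotAC_linearizedWindow_of_levelData` IS
`ShellMeasureWindowSection.slotAC_sectionWindow_of_levelData` — statement copied, proved through the curved END.
[folklore] -/
example (Ψ : (Kf × F) ≃L[ℝ] E) {Z : Type*} [MeasurableSpace Z]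
    (ζ : Measure Z) [SFinite ζ] {G : E × Z → ℝ≥0∞} (hG : Measurable G) {u : E × Z → ℝ} (hu : Measurable u)
    {σ : Z → F → E} (hσm : ∀ z, Measurable (σ z)) (hσ : ∀ z b, (Ψ.symm (σ z b)).2 = b)
    (hfin : ∀ z b, (μK.withDensity fun x => G (σ z b + Ψ (x, 0), z)) univ ≠ ∞)
    (Ttr : TraceData A) (hN : 0 < Ttr.N) {ι κ : Type*} {Pu : Finset ι} (hPu : Pu.Nonempty)
    (hol : Z → F → ι → Kf → A) (hcont : ∀ z b, ∀ p ∈ Pu, Continuous (hol z b p))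
    (Pw : Finset κ) (Gw : Z → F → κ → Kf → A) (𝓔 : Z → F → Kf → ℝ) (W : Z → F → Set Kf)
    (Jco : Z → F → Kf → ℝ≥0∞) {θ δ ρ β Rad H B𝓔 : ℝ} {sw lw dw : κ → ℝ}
    (hFdict : ∀ z b x, G (σ z b + Ψ (x, 0), z) = Jco z b x * weight Ttr β Pw (Gw z b) (𝓔 z b) x)
    (hudict : ∀ z b x, G (σ z b + Ψ (x, 0), z) ≠ 0 → u (σ z b + Ψ (x, 0), z) = classifier hPu (hol z b) x)
    (hJW : ∀ z b x, Jco z b x ≠ 0 → x ∈ W z b)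
    (hJ : ∀ z b x, ∀ a : ℝ, 0 ≤ a → Jco z b x ≤ Jco z b (Real.exp (-a) • x))
    (hRad : 1 < Rad)
    (hAN : ∀ z b, ∀ x ∈ W z b, ∀ p ∈ Pu, ∃ f : ℂ → A, DifferentiableOn ℂ f (ball 0 Rad) ∧
      (∀ w ∈ ball (0 : ℂ) Rad, ‖f w‖ ≤ H) ∧ f 0 = 0 ∧
      ∀ c' : ℝ, 0 ≤ c' → c' ≤ 1 → f (c' : ℂ) = hol z b p (c' • x) - 1)
    (hGW : ∀ z b, ∀ x ∈ W z b, ∀ p ∈ Pw, ∃ gw : List (MLetter A × ℝ × ℝ), (∀ y ∈ gw, y.1.Good Ttr.τ y.2.1 y.2.2) ∧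
      sSum gw ≤ sw p ∧ lSum gw ≤ lw p ∧ mdFro (gw.map Prod.fst) ≤ dw p ∧
      ∀ c' : ℝ, 0 ≤ c' → c' ≤ 1 → mwordEval c' (gw.map Prod.fst) = Gw z b p (c' • x))
    (hsw1 : ∀ p ∈ Pw, sw p ≤ 1) (hsw0 : ∀ p ∈ Pw, 0 ≤ sw p) (hlw0 : ∀ p ∈ Pw, 0 ≤ lw p)
    (hdw0 : ∀ p ∈ Pw, 0 ≤ dw p)
    (hE : ∀ z b, ∀ x ∈ W z b, ∀ c' : ℝ, 1 / 2 ≤ c' → c' ≤ 1 → 𝓔 z b (c' • x) ≤ 𝓔 z b x + (1 - c') * B𝓔)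
    (hB𝓔 : 0 ≤ B𝓔)
    (hθ : 0 < θ) (hδ0 : 0 ≤ δ) (hδ1 : δ < 1) (hρ0 : 0 ≤ ρ) (hρ : ρ ≤ (1 - δ) / 2) (hβ : 0 ≤ β)
    (hSM : 36 * H * 1 ^ 2 / (Rad - 1) ^ 2 ≤ δ * θ) :
    SlotAntiConcentration ((μE.prod ζ).withDensity G) u θ ρ
      (2 * ((Module.finrank ℝ Kf : ℝ) + (β * ∑ p ∈ Pw, lw p * (dw p + 4 * sw p) + B𝓔)) / (1 - δ)) := by
  have hGt : ∀ (z : Z) (y : E), G (y, z) = (univ : Set E).indicator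
      (fun y => ENNReal.ofReal |(ContinuousLinearMap.id ℝ E).det| * G (id y, z)) y := fun z y => by
    simp [ContinuousLinearMap.det]
  exact slotAC_linearizedWindow_of_levelData μE μK (fun _ => Ψ) ζ hG hu (O := fun _ => univ)
    (fun _ => MeasurableSet.univ) (Φ := fun _ => id) (fun _ => measurable_id) (fun _ => injOn_id _)
    (Φ' := fun _ _ => ContinuousLinearMap.id ℝ E) (fun _ y _ => hasFDerivWithinAt_id y univ)
    (fun z y _ => ⟨y, mem_univ _, rfl⟩) hσm hσ (Gt := fun z y => G (y, z))
    (fun z => hG.comp measurable_prodMk_right) hGt hfin Ttr hN hPu hol hcont Pw Gw 𝓔 W Jco hFdict hudict hJW hJ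
    hRad hAN hGW hsw1 hsw0 hlw0 hdw0 hE hB𝓔 hθ hδ0 hδ1 hρ0 hρ hβ hSM

end End

end Summit.QuantumFields.BalabanUV.T4Continuum.ShellMeasureLinearizedChart

end
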